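import Summits.ValiantsHypothesis.ValiantsHypothesis.Theorems.KPlusLogSqLawTropicalBUpperBand

/-!
# Route «KPlusLogSqLaw», crux `TropicalB` (stmt-ValiantsHypothesis-19771) — TWO-SIDED BANDED designs are POLYNOMIAL:
# `|a − b| ≤ u ⇒ n + 1 ≤ (mK+1) · 2^{(4u+1)(⌊log₂ m⌋+1)} ≤ (mK+1) · (2m)^{4u+1}`

HONEST FRAMING.  A refuter-side structural fact (seat val-sym-trop-p5, refuter-adjacent lane; desk dockets D2/D3 «which constructions
can grow») toward the registered stubs `stub_tropThin` / `stub_tropFat` of `Cruxes/TropicalB/Lines/birth.lean` (crux `TropicalB`, item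
stmt-ValiantsHypothesis-19771, route KPlusLogSqLaw).  Instance of the all-states meta-theorem `IntervalOpt.chain_le_of_states`
(`KPlusLogSqLawTropicalBUpperBand.lean`) with a CONSTANT number of cut states: for a design whose entry in row `a`, column `b` is
present only if `a ≤ b + u` AND `b ≤ a + u` (bandwidth `u` on both sides), the image of a column interval `[a, t)` differs from
`[a, t)` only inside the four windows `[a, a+u)`, `[t−u, t)` (rows removed) and `[a−u, a)`, `[t, t+u)` (rows added), so it is one
of `≤ 16^u` row sets (`image_mem_bandShapes`, `card_bandShapes_le`), INDEPENDENTLY of `m`.  Hence every dominant chain with distinct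
consecutive terms — in particular every sign-alternating one — has

  `n + 1 ≤ (mK + 1) · 2^{(4u+1)(⌊log₂ m⌋ + 1)} ≤ (mK + 1) · (2m)^{4u+1}`   (`chain_le_banded`, `chain_lt_banded_poly`),

POLYNOMIAL in `m` of degree `4u + 2` for fixed bandwidth: two-sided banded supports («registers of bounded width») can never
carry super-polynomial breakpoint growth, in contrast with ONE-sided bounded jumps (Hessenberg, `a ≤ b + 1`), which host the
Carstensen–Mulmuley–Shah `m^{Ω(log m)}` path families.  (The sibling K-adaptive banded rung of trop-p3, `band_kPlusLogSq`, is the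
one-sided class with the `K + log² m` shape; this file is the two-sided class with a polynomial shape.)  Nothing here bears on
`TropicalB` for general supports, on `MatrixDescartes` (stmt-ValiantsHypothesis-18050) or on VP ≠ VNP.
[folklore: bounded-width transfer matrices / Gusfield's recursion with O(1) states]
-/

set_option linter.dupNamespace false
set_option autoImplicit false

namespace Summit.ValiantsHypothesis.ValiantsHypothesis.Theorems.KPlusLogSqLaw

open Summit.ValiantsHypothesis.ValiantsHypothesis.Theorems.MatrixDescartes.Negative
open Summit.ValiantsHypothesis.ValiantsHypothesis.Theorems.LacunarySymmetroidMatrixDescartes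
open scoped BigOperators
open Finset

namespace IntervalOpt

variable {m K : ℕ} {d : Fin K → ℕ} {v ε : Fin m → Fin m → Fin K → ℤ}

/-- the candidate images of `[a, t)` under a permutation of bandwidth `u`: remove a subset of `[a, a+u) ∪ [t−u, t)`, add a subset of
`[a−u, a) ∪ [t, t+u)`. [folklore] -/
noncomputable def bandShapes (m u a t : ℕ) : Finset (Finset (Fin m)) :=
  ((ico m a (a + u) ∪ ico m (t - u) t).powerset ×ˢ (ico m (a - u) a ∪ ico m t (t + u)).powerset).image
    fun XW => (ico m a t \ XW.1) ∪ XW.2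

/-- **Constantly many band shapes**: `#bandShapes m u a t ≤ 2^{2u} · 2^{2u}`, independently of `m`. [folklore] -/
theorem card_bandShapes_le (u a t : ℕ) : (bandShapes m u a t).card ≤ 2 ^ (2 * u) * 2 ^ (2 * u) := by
  classical
  have hw1 : (ico m a (a + u) ∪ ico m (t - u) t).card ≤ 2 * u := by
    calc _ ≤ (ico m a (a + u)).card + (ico m (t - u) t).card := Finset.card_union_le _ _
      _ ≤ (a + u - a) + (t - (t - u)) := Nat.add_le_add (card_ico_le _ _) (card_ico_le _ _)
      _ ≤ 2 * u := by omega
  have hw2 : (ico m (a - u) a ∪ ico m t (t + u)).card ≤ 2 * u := by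
    calc _ ≤ (ico m (a - u) a).card + (ico m t (t + u)).card := Finset.card_union_le _ _
      _ ≤ (a - (a - u)) + (t + u - t) := Nat.add_le_add (card_ico_le _ _) (card_ico_le _ _)
      _ ≤ 2 * u := by omega
  unfold bandShapes
  calc _ ≤ _ := Finset.card_image_le
    _ = _ := Finset.card_product _ _
    _ ≤ 2 ^ (2 * u) * 2 ^ (2 * u) := by
        rw [Finset.card_powerset, Finset.card_powerset]
        exact Nat.mul_le_mul (Nat.pow_le_pow_right (by norm_num) hw1) (Nat.pow_le_pow_right (by norm_num) hw2)

/-- **The image of a column interval under a banded permutation is a band shape.** [folklore] -/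
theorem image_mem_bandShapes {u : ℕ} {σ : Equiv.Perm (Fin m)}
    (hband : ∀ i : Fin m, ((σ i : Fin m) : ℕ) ≤ (i : ℕ) + u ∧ (i : ℕ) ≤ ((σ i : Fin m) : ℕ) + u) (a t : ℕ) :
    (ico m a t).image σ ∈ bandShapes m u a t := by
  classical
  set J := ico m a t with hJ
  set R := J.image σ with hR
  -- rows of `J` not hit from `J` are hit from outside `J`, hence lie in the two inner windows
  have hX : J \ R ⊆ ico m a (a + u) ∪ ico m (t - u) t := by
    intro r hr
    rw [Finset.mem_sdiff] at hr
    have hrJ := hr.1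
    rw [hJ, mem_ico] at hrJ
    -- `r = σ i` with `i ∉ J`
    have hi : σ.symm r ∉ J := by
      intro hi
      exact hr.2 (Finset.mem_image.2 ⟨σ.symm r, hi, by simp⟩)
    rw [hJ, mem_ico] at hi
    have hb := hband (σ.symm r)
    simp only [Equiv.apply_symm_apply] at hb
    rw [Finset.mem_union, mem_ico, mem_ico]
    omega
  -- rows outside `J` hit from `J` lie in the two outer windows
  have hW : R \ J ⊆ ico m (a - u) a ∪ ico m t (t + u) := by
    intro r hr
    rw [Finset.mem_sdiff] at hr
    obtain ⟨i, hi, rfl⟩ := Finset.mem_image.1 hr.1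
    rw [hJ, mem_ico] at hi
    have hni : ¬ (a ≤ ((σ i : Fin m) : ℕ) ∧ ((σ i : Fin m) : ℕ) < t) := fun h => hr.2 (by rw [hJ, mem_ico]; exact h)
    have hb := hband i
    rw [Finset.mem_union, mem_ico, mem_ico]
    omega
  unfold bandShapes
  refine Finset.mem_image.2 ⟨(J \ R, R \ J), ?_, ?_⟩
  · rw [Finset.mem_product, Finset.mem_powerset, Finset.mem_powerset]
    exact ⟨hX, hW⟩
  · ext r
    simp only [Finset.mem_union, Finset.mem_sdiff]
    tauto

/-- a present term of a design of bandwidth `u` is a banded permutation. [folklore] -/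
theorem banded_of_present {u : ℕ}
    (hB : ∀ (a b : Fin m) (l : Fin K), ε a b l ≠ 0 → (a : ℕ) ≤ (b : ℕ) + u ∧ (b : ℕ) ≤ (a : ℕ) + u)
    {p : Equiv.Perm (Fin m) × (Fin m → Fin K)} (hp : termSign ε p ≠ 0) (i : Fin m) :
    ((p.1 i : Fin m) : ℕ) ≤ (i : ℕ) + u ∧ (i : ℕ) ≤ ((p.1 i : Fin m) : ℕ) + u :=
  hB _ _ _ ((termSign_ne_zero_iff ε p).1 hp i)

/-- **Banded designs are polynomial (chain form).**  For a design of bandwidth `u` (entry `(a, b)` present only if `|a − b| ≤ u`),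
every dominant chain with distinct consecutive terms has `n + 1 ≤ (mK+1) · 2^{(4u+1)(⌊log₂ m⌋+1)}`. [folklore] -/
theorem chain_le_banded {u : ℕ}
    (hB : ∀ (a b : Fin m) (l : Fin K), ε a b l ≠ 0 → (a : ℕ) ≤ (b : ℕ) + u ∧ (b : ℕ) ≤ (a : ℕ) + u) {n : ℕ}
    (θ : Fin (n + 1) → ℤ) (p : Fin (n + 1) → Equiv.Perm (Fin m) × (Fin m → Fin K)) (hθ : StrictMono θ)
    (hdom : ∀ k, IsDominant d v ε (θ k) (p k)) (hne : ∀ k : Fin n, p k.castSucc ≠ p k.succ) :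
    n + 1 ≤ (m * K + 1) * 2 ^ ((4 * u + 1) * (Nat.log 2 m + 1)) := by
  have h := chain_le_of_states (d := d) (v := v) (ε := ε) (bandShapes m u) (2 ^ (2 * u) * 2 ^ (2 * u))
    (Nat.one_le_iff_ne_zero.2 (by positivity)) (fun a t => card_bandShapes_le u a t)
    (fun _ hq a t => image_mem_bandShapes (banded_of_present hB hq) a t) θ p hθ hdom hne
  have he : 2 * (2 ^ (2 * u) * 2 ^ (2 * u)) = 2 ^ (4 * u + 1) := by
    rw [← pow_add, ← pow_succ']; ring_nf
  rw [he, ← pow_mul] at h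
  exact h

/-- **Banded designs are polynomial (explicit degree).**  For `m ≥ 1` and bandwidth `u`: `n < (mK+1) · (2m)^{4u+1}`. [folklore] -/
theorem chain_lt_banded_poly {u : ℕ} (hm : 1 ≤ m)
    (hB : ∀ (a b : Fin m) (l : Fin K), ε a b l ≠ 0 → (a : ℕ) ≤ (b : ℕ) + u ∧ (b : ℕ) ≤ (a : ℕ) + u) {n : ℕ}
    (θ : Fin (n + 1) → ℤ) (p : Fin (n + 1) → Equiv.Perm (Fin m) × (Fin m → Fin K)) (hθ : StrictMono θ)
    (hdom : ∀ k, IsDominant d v ε (θ k) (p k)) (hne : ∀ k : Fin n, p k.castSucc ≠ p k.succ) :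
    n < (m * K + 1) * (2 * m) ^ (4 * u + 1) := by
  have h := chain_le_banded hB θ p hθ hdom hne
  have hL : 2 ^ (Nat.log 2 m + 1) ≤ 2 * m := by
    rw [pow_succ]
    have := Nat.pow_log_le_self 2 (by omega : m ≠ 0)
    omega
  have h2 : 2 ^ ((4 * u + 1) * (Nat.log 2 m + 1)) ≤ (2 * m) ^ (4 * u + 1) := by
    rw [mul_comm, pow_mul]
    exact Nat.pow_le_pow_left hL _
  have h3 := Nat.mul_le_mul_left (m * K + 1) h2
  omega

/-- **Banded designs are polynomial (unsigned row form)**: `DesignRowD d v ε ((mK+1) · 2^{(4u+1)(⌊log₂ m⌋+1)} − 1)` for every design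
of bandwidth `u`. [folklore] -/
theorem designRowD_banded_poly (u : ℕ) (d : Fin K → ℕ) (v ε : Fin m → Fin m → Fin K → ℤ)
    (hB : ∀ (a b : Fin m) (l : Fin K), ε a b l ≠ 0 → (a : ℕ) ≤ (b : ℕ) + u ∧ (b : ℕ) ≤ (a : ℕ) + u) :
    DesignRowD d v ε ((m * K + 1) * 2 ^ ((4 * u + 1) * (Nat.log 2 m + 1)) - 1) := by
  intro n θ p hθ hdom hne
  have h := chain_le_banded hB θ p hθ hdom hne
  omega

end IntervalOpt

open IntervalOpt in
/-- **Two-sided banded designs obey `TropicalB`'s inequality with NO `log² m` term**: for every `u`, every tropical design whose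
entry `(a, b)` is present only if `|a − b| ≤ u` admits fewer than `(mK+1)·(2m)^{4u+1}` terms in any strictly increasing integer
parameter sequence of dominant terms with alternating signs (`m ≥ 1`) — polynomial in `m` for fixed bandwidth.  [folklore] -/
theorem tropicalB_banded_polynomial (u : ℕ) : ∀ (m K : ℕ) (d : Fin K → ℕ) (v ε : Fin m → Fin m → Fin K → ℤ) (n : ℕ)
    (θ : Fin (n + 1) → ℤ) (p : Fin (n + 1) → Equiv.Perm (Fin m) × (Fin m → Fin K)), 1 ≤ m →
    (∀ (a b : Fin m) (l : Fin K), ε a b l ≠ 0 → (a : ℕ) ≤ (b : ℕ) + u ∧ (b : ℕ) ≤ (a : ℕ) + u) →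
    (∀ i j l, (ε i j l).natAbs ≤ 1) → StrictMono θ → (∀ k, IsDominant d v ε (θ k) (p k)) →
    (∀ k : Fin n, termSign ε (p k.castSucc) * termSign ε (p k.succ) < 0) → n < (m * K + 1) * (2 * m) ^ (4 * u + 1) :=
  fun _ _ _ _ ε _ θ p hm hB _ hθ hdom halt =>
    chain_lt_banded_poly hm hB θ p hθ hdom (ne_succ_of_alternating ε p halt)

end Summit.ValiantsHypothesis.ValiantsHypothesis.Theorems.KPlusLogSqLaw
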